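import Summits.BirchSwinnertonDyer.BirchSwinnertonDyer.Theorems.ByReductionTypeAtTwoMultTowerSplitExactLower
import Summits.BirchSwinnertonDyer.BirchSwinnertonDyer.Theorems.ByReductionTypeAtTwoMultTowerSplitExactTransfer
import Summits.BirchSwinnertonDyer.BirchSwinnertonDyer.Theorems.ByReductionTypeAtTwoMultTowerSplitOrderBound
import Summits.BirchSwinnertonDyer.BirchSwinnertonDyer.Theorems.ByReductionTypeAtTwoMultTowerNS2LayerNormGroup
import HarnessLib

/-!
# Route `ByReductionTypeAtTwo`, crux `MultUpperHalfAtTwo` (item stmt-BirchSwinnertonDyer-19922), TOWER road, SPLIT rows: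
# the EXACT order of the local tower kernel at a split multiplicative `2`, part 3 —
# `#𝒦_{v,n}[2^∞] = 2^{ord₂(log₂ q_E) − 2}` at EVERY layer: Greenberg's `|ker(r_v)| ∼ log₂(q_E)/4` at `p = 2` is KERNEL

HONEST FRAMING (cell `bsd-2adic`, run/shared/lean/pub/bsd-2adic/, seat `bsd-2adic-tower-1` GEN 27, HUMAN RULINGS
D-0036 / D-0054 / D-0074): theorems only (no definition, no named fact, no `sorry`); closes no item by itself; nothing
booked; BSD is not proved by any of this. The PRINT binder `hSP = Greenberg1999.sec3_natCard_localTowerKerPrimary_splitMultiplicative_rat`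
(Greenberg, LNM 1716, §3 pp. 92–93: at a SPLIT multiplicative `v ∣ p`, `|ker(r_{v_n})| ∼ log_p(N q_E)/2p[…]`; over `ℚ`:
`#𝒦_{v,n}[p^∞] = p^e`, `e + ord_p(2p) = ord_p(log_p q_E)`, every layer) is stated for EVERY prime `p`. Seat bsd-2adic-mult
GEN 13 proved its UPPER half at `p = 2` (`MultTowerSplitOrder.finite_and_natCard_localTowerKerPrimary_le_pow_splitTwo`).
THIS FILE PROVES THE `p = 2` CLAUSE IN FULL (equality):

* `toZModPow_units_pow_two_pow_of_norm_sq_sub_one` — `2`-adic: `‖u² − 1‖ ≤ 2^{−(w+3)}` ⇒ `u^{2^n} ≡ ±1 (mod 2^{n+w+2})`;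
* `pow_mem_range_norm_layer_splitTwo` — hence `q_E^{2^n} ∈ N(F_{n+w}ˣ)` (norms to `ℚ_v`) by GEN 9's BRICK 14
  `MultTowerNS2.mem_range_norm_fixedField_layer_iff` (`N(F_mˣ) = ⟨2⟩·±(1 + 2^{m+2}ℤ₂)`, from the explicit norms
  `N(1 + y_m) = −1`, `N(2 + y_m) = 2` and the class field axiom);
* `pow_le_natCard_localTowerKerPrimary_splitTwo` — **`2^w ≤ #𝒦_{v,n}[2^∞]`** for `ord₂(log₂ q_E) = w + 2` (part 2's
  transfer gives `x ∈ F_{n+w}` with `N_{F_{n+w}/F_n}(x) = q_E`; part 1 gives the class of order exactly `2^w`);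
* `finite_and_natCard_localTowerKerPrimary_eq_pow_splitTwo` — **`Finite 𝒦_{v,n}[2^∞] ∧ #𝒦_{v,n}[2^∞] = 2^w`**;
* `sec3_natCard_localTowerKerPrimary_splitMultiplicative_two` — **the `p = 2` clause of the named fact hSP, verbatim body**
  (`∃ e, e + ord₂(4) = ord₂(log₂ q_E) ∧ ∀ n, Finite ∧ # = 2^e`); the `∀ p` fact itself additionally needs the odd-`p` clause
  (norm group `⟨p⟩·μ_{p−1}·(1 + p^{m+1}ℤ_p)` of `F_m` and the odd-`p` count) — not in this file.

References: R. Greenberg, LNM 1716 (1999), §3 pp. 85–93 (pp. 92–93 «constant as n varies», «|ker(r_v)| ∼ log_p(q_E)/2p»);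
J. Silverman, GTM 151, V.3–V.5; J. Neukirch, *ANT* IV (3.5), V (1.1); K. Iwasawa, *Lectures on p-adic L-functions* §4.4;
cell memos NOTE-SP1ONE.md §5, NOTE-HNS2-KERNEL-GEN27.md.
-/

set_option autoImplicit false
-- the Theorems namespace of this sub repeats the summit name by design (D-0017 nested layout: Summit.<S>.<Sub>)
set_option linter.dupNamespace false

noncomputable section

open scoped Classical

namespace Summit.BirchSwinnertonDyer.BirchSwinnertonDyer.Theorems.MultTowerSplitExact

open NumberField IsDedekindDomain Field WeierstrassCurve PadicInt Rat.HeightOneSpectrum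
  Literature.NumberTheory.EllipticCurves Literature.NumberTheory.EllipticCurves.ResKernel
  Literature.NumberTheory.GaloisRepresentations
  Summit.BirchSwinnertonDyer.BirchSwinnertonDyer.Theorems.MultTowerNS2
  Summit.BirchSwinnertonDyer.BirchSwinnertonDyer.Theorems.MultTowerSplitOrder

/-! ### `2`-adic units: `‖u² − 1‖ ≤ 2^{−(w+3)} ⇒ u^{2^n} ≡ ±1 (mod 2^{n+w+2})` -/

/-- A unit of `ℤ₂` is `≡ 1` or `≡ −1 (mod 4)`, i.e. `‖u − 1‖ < ‖2‖` or `‖u + 1‖ < ‖2‖`. [folklore] -/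
theorem norm_sub_one_lt_or_norm_add_one_lt (u : ℤ_[2]ˣ) :
    ‖(u : ℤ_[2]) - 1‖ < ‖(2 : ℤ_[2])‖ ∨ ‖(u : ℤ_[2]) + 1‖ < ‖(2 : ℤ_[2])‖ := by
  have key : ∀ t t' : ZMod (2 ^ 2), t * t' = 1 → t = 1 ∨ t = -1 := by decide
  have hu := key (toZModPow 2 (u : ℤ_[2])) (toZModPow 2 ((u⁻¹ : ℤ_[2]ˣ) : ℤ_[2]))
    (by rw [← map_mul, Units.mul_inv, map_one])
  have h4 : (2 : ℝ) ^ (-((2 : ℕ) : ℤ)) < ‖(2 : ℤ_[2])‖ := by rw [norm_two_padicInt]; norm_num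
  rcases hu with h | h
  · left
    have h1 : toZModPow 2 (u : ℤ_[2]) = toZModPow 2 1 := by rw [h, map_one]
    exact lt_of_le_of_lt ((toZModPow_eq_iff_norm_sub_le 2 _ _).mp h1) h4
  · right
    have h1 : toZModPow 2 (u : ℤ_[2]) = toZModPow 2 (-1) := by rw [h, map_neg, map_one]
    have h2 := (toZModPow_eq_iff_norm_sub_le 2 _ _).mp h1
    rw [sub_neg_eq_add] at h2
    exact lt_of_le_of_lt h2 h4

/-- **`u^{2^n} ≡ ±1 (mod 2^{n+w+2})` when `‖u² − 1‖ ≤ 2^{−(w+3)}`** (`u ∈ ℤ₂ˣ`): with `y = ±u`, `‖y − 1‖ < ‖2‖`, one has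
`‖y − 1‖ = ‖u² − 1‖/‖2‖ ≤ 2^{−(w+2)}` and `‖y^{2^n} − 1‖ = ‖y − 1‖·‖2‖^n ≤ 2^{−(n+w+2)}`, and `u^{2^n} = ±y^{2^n}`. [folklore] -/
theorem toZModPow_units_pow_two_pow_of_norm_sq_sub_one (u : ℤ_[2]ˣ) {w : ℕ}
    (hu : ‖(u : ℤ_[2]) ^ 2 - 1‖ ≤ (2 : ℝ) ^ (-((w : ℤ) + 3))) (n : ℕ) :
    toZModPow (n + w + 2) (((u ^ 2 ^ n : ℤ_[2]ˣ) : ℤ_[2])) = 1 ∨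
      toZModPow (n + w + 2) (((u ^ 2 ^ n : ℤ_[2]ˣ) : ℤ_[2])) = -1 := by
  have h2 : ‖(2 : ℤ_[2])‖ = (2 : ℝ)⁻¹ := norm_two_padicInt
  -- `y = ε u` with `‖y − 1‖ < ‖2‖`
  obtain ⟨ε, hε, hy⟩ : ∃ ε : ℤ_[2], (ε = 1 ∨ ε = -1) ∧ ‖ε * (u : ℤ_[2]) - 1‖ < ‖(2 : ℤ_[2])‖ := by
    rcases norm_sub_one_lt_or_norm_add_one_lt u with h | h
    · exact ⟨1, Or.inl rfl, by rwa [one_mul]⟩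
    · refine ⟨-1, Or.inr rfl, ?_⟩
      rw [neg_one_mul, ← norm_neg, neg_sub, sub_neg_eq_add, add_comm]
      exact h
  set y : ℤ_[2] := ε * (u : ℤ_[2]) with hydef
  have hε2 : ε ^ 2 = 1 := by rcases hε with rfl | rfl <;> norm_num
  have hy2 : y ^ 2 = (u : ℤ_[2]) ^ 2 := by rw [hydef, mul_pow, hε2, one_mul]
  -- `‖y − 1‖ ≤ 2^{−(w+2)}`
  have hy1 : ‖y - 1‖ ≤ (2 : ℝ) ^ (-((w : ℤ) + 2)) := by
    have h := norm_sq_sub_one_of_norm_sub_one_lt hy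
    rw [hy2, h2] at h
    have h' : ‖y - 1‖ = ‖(u : ℤ_[2]) ^ 2 - 1‖ * 2 := by
      field_simp at h; linarith [h]
    rw [h']
    calc ‖(u : ℤ_[2]) ^ 2 - 1‖ * 2 ≤ (2 : ℝ) ^ (-((w : ℤ) + 3)) * 2 := by gcongr
      _ = (2 : ℝ) ^ (-((w : ℤ) + 2)) := by
        rw [show -((w : ℤ) + 2) = -((w : ℤ) + 3) + 1 by ring, zpow_add₀ (by norm_num : (2 : ℝ) ≠ 0), zpow_one]
  -- `‖y^{2^n} − 1‖ ≤ 2^{−(n+w+2)}`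
  have hyn : ‖y ^ 2 ^ n - 1‖ ≤ (2 : ℝ) ^ (-(((n + w + 2 : ℕ) : ℤ))) := by
    rw [norm_pow_two_pow_sub_one hy n, h2, inv_pow, ← zpow_natCast, ← zpow_neg]
    calc ‖y - 1‖ * (2 : ℝ) ^ (-(n : ℤ)) ≤ (2 : ℝ) ^ (-((w : ℤ) + 2)) * (2 : ℝ) ^ (-(n : ℤ)) := by
          gcongr
      _ = (2 : ℝ) ^ (-(((n + w + 2 : ℕ) : ℤ))) := by
        rw [← zpow_add₀ (by norm_num : (2 : ℝ) ≠ 0)]; congr 1; push_cast; ring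
  have hyn' : toZModPow (n + w + 2) (y ^ 2 ^ n) = 1 := by
    have h := (toZModPow_eq_iff_norm_sub_le (n + w + 2) (y ^ 2 ^ n) 1).mpr hyn
    rwa [map_one] at h
  -- `u^{2^n} = ε^{2^n} y^{2^n}`
  have hup : ((u ^ 2 ^ n : ℤ_[2]ˣ) : ℤ_[2]) = ε ^ 2 ^ n * y ^ 2 ^ n := by
    rw [Units.val_pow_eq_pow_val, hydef, mul_pow, ← mul_assoc, ← mul_pow, ← sq, hε2, one_pow, one_mul]
  have hεn : ε ^ 2 ^ n = 1 ∨ ε ^ 2 ^ n = -1 := by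
    rcases hε with rfl | rfl
    · exact Or.inl (one_pow _)
    · rcases Nat.even_or_odd (2 ^ n) with h | h
      · exact Or.inl h.neg_one_pow
      · exact Or.inr h.neg_one_pow
  rcases hεn with h | h
  · left; rw [hup, h, one_mul, hyn']
  · right; rw [hup, h, neg_one_mul, map_neg, hyn']

/-! ### The `p = 2` assembly -/

variable {κ : ZpExtension ℚ 2}

/-- **`2^w ≤ #𝒦_{v,n}[2^∞]` at a split multiplicative `2` with `ord₂(log₂ q_E) = w + 2`** (every cyclotomic `κ`, `v ∋ 2`,
every layer `n`). Proof: uniformise (BRICK S3), read `q_E = 2^k u` with `‖u² − 1‖ = 2^{−(w+3)}`; then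
`q_E^{2^n} = 2^{k2^n}·u^{2^n}` with `u^{2^n} ≡ ±1 (mod 2^{n+w+2})` lies in `N(F_{n+w}ˣ)` (BRICK 14); the transfer (part 2)
gives `x ∈ F_{n+w}` with `N_{F_{n+w}/F_n}(x) = q_E`, whose class has order exactly `2^w` (part 1).
[cite: GreenbergLNM1716, §3, between Prop. 3.6 and Prop. 3.7 (PDF pp. 92–93)] [cite: SilvermanATAEC1994, Thm. V.3.1, V.5.3]
[cite: NeukirchANT1999, Ch. IV (3.5) and Ch. V §1 Thm. (1.1)] -/
theorem pow_le_natCard_localTowerKerPrimary_splitTwo (W : WeierstrassCurve ℚ) [W.IsElliptic]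
    (Dq : TateParameterData W 2) (hlog : padicLog 2 Dq.q ≠ 0) {w : ℕ}
    (hw : (padicLog 2 Dq.q).valuation = (w : ℤ) + 2) (κ : ZpExtension ℚ 2) (hκ : κ.IsCyclotomic)
    (v : HeightOneSpectrum (𝓞 ℚ)) (hv : ((2 : ℕ) : 𝓞 ℚ) ∈ v.asIdeal) (n : ℕ) :
    2 ^ w ≤ Nat.card (W.localTowerKerPrimary κ (v.adicCompletion ℚ) n) := by
  -- the uniformisation at `v` and the identification with `Dq.q`
  have hsplitv := hasSplitMultiplicativeReductionAt_of_atPrime W v hv Dq.split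
  obtain ⟨q, Φ, hq0, hq1, hqj, hsurj, hker, hequiv⟩ := exists_tateUniformisation_tateJ W v hsplitv
  obtain ⟨e, he⟩ := exists_ringEquiv_tateParameter 2 v hv
  have heq : e q = Dq.q := he W q hq0 hq1 hqj Dq
  obtain ⟨k', u, hqu⟩ := exists_eq_two_pow_mul_units Dq.q_ne_zero Dq.norm_q_lt_one
  -- the depth: `‖u² − 1‖ = 2^{−(w+3)}` from `ord₂ log₂ q = w + 2`
  have hu : ‖(u : ℤ_[2]) ^ 2 - 1‖ ≤ (2 : ℝ) ^ (-((w : ℤ) + 3)) := by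
    have hu0 : ((u : ℤ_[2]) : ℚ_[2]) ≠ 0 := fun h ↦ u.ne_zero (PadicInt.coe_eq_zero.mp h)
    have hlogq : padicLog 2 Dq.q = padicLog 2 ((u : ℤ_[2]) : ℚ_[2]) := by rw [hqu, padicLog_two_pow_mul k' hu0]
    have hn := norm_padicLog_units_eq u
    rw [← hlogq, Padic.norm_eq_zpow_neg_valuation hlog, hw] at hn
    have h : ‖(u : ℤ_[2]) ^ 2 - 1‖ = (2 : ℝ) ^ (-((w : ℤ) + 3)) := by
      rw [show -((w : ℤ) + 3) = -((w : ℤ) + 2) + (-1) by ring, zpow_add₀ (by norm_num : (2 : ℝ) ≠ 0)]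
      push_cast at hn
      rw [zpow_neg_one]
      linarith [hn]
    exact h.le
  have hq : e q = (2 : ℚ_[2]) ^ k' * ((u : ℤ_[2]) : ℚ_[2]) := by rw [heq, hqu]
  have hu' : ‖(u : ℤ_[2]) ^ 2 - 1‖ = (2 : ℝ) ^ (-((w : ℤ) + 3)) := by
    refine le_antisymm hu ?_
    -- the reverse inequality is not needed below except through GEN 13's count; derive it from `hw` as well
    have hu0 : ((u : ℤ_[2]) : ℚ_[2]) ≠ 0 := fun h ↦ u.ne_zero (PadicInt.coe_eq_zero.mp h)
    have hlogq : padicLog 2 Dq.q = padicLog 2 ((u : ℤ_[2]) : ℚ_[2]) := by rw [hqu, padicLog_two_pow_mul k' hu0]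
    have hn := norm_padicLog_units_eq u
    rw [← hlogq, Padic.norm_eq_zpow_neg_valuation hlog, hw] at hn
    rw [show -((w : ℤ) + 3) = -((w : ℤ) + 2) + (-1) by ring, zpow_add₀ (by norm_num : (2 : ℝ) ≠ 0)]
    push_cast at hn
    rw [zpow_neg_one]
    linarith [hn]
  -- equivariance in value form
  have hequiv' : ∀ (σ : absoluteGaloisGroup (v.adicCompletion ℚ)) (w₁ w' : (AlgebraicClosure (v.adicCompletion ℚ))ˣ),
      (w' : AlgebraicClosure (v.adicCompletion ℚ)) = σ • (w₁ : AlgebraicClosure (v.adicCompletion ℚ)) →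
        σ • Φ (Additive.ofMul w₁) = Φ (Additive.ofMul w') := by
    intro σ w₁ w' h
    have hw' : w' = Units.map (absoluteGaloisGroup.toAlgEquiv (v.adicCompletion ℚ) σ :
        AlgebraicClosure (v.adicCompletion ℚ) →* AlgebraicClosure (v.adicCompletion ℚ)) w₁ := Units.ext h
    rw [hw']
    exact hequiv σ w₁
  -- the Tate parameter in `K̄_v`
  set Q : AlgebraicClosure (v.adicCompletion ℚ) := algebraMap (v.adicCompletion ℚ) (AlgebraicClosure (v.adicCompletion ℚ)) q
    with hQ
  have hQ0 : Q ≠ 0 := by rw [hQ]; exact (map_ne_zero _).mpr hq0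
  have hQfix : ∀ σ : absoluteGaloisGroup (v.adicCompletion ℚ), σ • Q = Q := fun σ ↦
    AlgEquiv.commutes (absoluteGaloisGroup.toAlgEquiv _ σ) q
  have hQtor : ∀ j : ℤ, Q ^ j = 1 → j = 0 := by
    intro j hj
    have hj' : q ^ j = 1 := by
      apply (algebraMap (v.adicCompletion ℚ) (AlgebraicClosure (v.adicCompletion ℚ))).injective
      rw [map_zpow₀, map_one]; exact hj
    have hpow : ∀ m : ℕ, q ^ m = 1 → m = 0 := fun m hm ↦ by
      by_contra hm0
      have h1 : ‖q‖ ^ m < 1 := pow_lt_one₀ (norm_nonneg q) hq1 hm0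
      rw [← norm_pow, hm, norm_one] at h1
      exact lt_irrefl _ h1
    cases j with
    | ofNat m =>
      rw [Int.ofNat_eq_natCast, zpow_natCast] at hj'
      rw [Int.ofNat_eq_natCast, hpow m hj']
      rfl
    | negSucc m =>
      rw [zpow_negSucc, inv_eq_one] at hj'
      exact absurd (hpow (m + 1) hj') (Nat.succ_ne_zero m)
  -- a topological generator
  obtain ⟨g, hgn, hgen⟩ := ZpExtension.exists_mem_localSubgroup_generate κ (v.adicCompletion ℚ) n
  obtain ⟨ug, hug⟩ := MultTowerSP1.exists_units_kappa_resGal_eq_of_generate hκ v hv n hgn hgen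
  -- finiteness of the `2`-primary coinvariants (GEN 13's count)
  obtain ⟨hfinT, -⟩ := finite_primaryComponent_coinvariants_and_card_le hκ v hv hsurj hker hequiv' hq0 hq1 e hq hu'
    n hgn hgen
  haveI := hfinT
  -- the witness `x ∈ F_{n+w}` with `N_w(x) = ∏_{i<2^w} g^i x = q`
  obtain ⟨x, hxw, hNx⟩ : ∃ x : (AlgebraicClosure (v.adicCompletion ℚ))ˣ,
      (∀ h ∈ localSubgroup (κ.layerSubgroup (n + w)) (v.adicCompletion ℚ),
        h • (x : AlgebraicClosure (v.adicCompletion ℚ)) = x) ∧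
      (∏ i ∈ Finset.range (2 ^ w), (g ^ i) • (x : AlgebraicClosure (v.adicCompletion ℚ))) = Q := by
    rcases Nat.eq_zero_or_pos w with rfl | hwpos
    · -- `w = 0`: `x = q` itself
      refine ⟨Units.mk0 Q hQ0, fun h _ ↦ by rw [Units.val_mk0]; exact hQfix h, ?_⟩
      rw [pow_zero, Finset.prod_range_one, pow_zero, one_smul, Units.val_mk0]
    · -- `q^{2^n} ∈ N(F_{n+w}ˣ)` by BRICK 14, then the transfer (part 2)
      set qu : (v.adicCompletion ℚ)ˣ := Units.mk0 q hq0 with hqu_def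
      have hmem : qu ^ 2 ^ n ∈ (Units.map (Algebra.norm (v.adicCompletion ℚ) :
          IntermediateField.fixedField (localSubgroup (κ.layerSubgroup (n + w)) (v.adicCompletion ℚ)) →*
            v.adicCompletion ℚ)).range := by
        rw [mem_range_norm_fixedField_layer_iff hκ v hv (m := n + w) (by omega) 2 rfl e]
        refine ⟨((k' * 2 ^ n : ℕ) : ℤ), u ^ 2 ^ n, toZModPow_units_pow_two_pow_of_norm_sq_sub_one u hu n, ?_⟩
        rw [hqu_def, Units.val_pow_eq_pow_val, Units.val_mk0, map_pow, hq, mul_pow, ← pow_mul, zpow_natCast,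
          Units.val_pow_eq_pow_val, PadicInt.coe_pow]
        norm_num
      obtain ⟨x, hxw, hNx⟩ := exists_prod_smul_eq_of_pow_mem_range_norm hκ v hv n w hgn hug qu hmem
      rw [hqu_def, Units.val_mk0] at hNx
      exact ⟨x, hxw, hNx⟩
  exact pow_le_natCard_localTowerKerPrimary_of_prod_smul_eq hκ v hv W hsurj hker hequiv' hQfix hQ0 hQtor n hgn hgen w
    hxw hNx

/-- **`ord₂(log₂ q_E) ≥ 2`** for a Tate parameter at `2` with `log₂ q_E ≠ 0`: `‖log₂ q_E‖ = ‖log₂ u‖ = 2‖u² − 1‖ ≤ 2·2^{−3}`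
(`u² ≡ 1 (mod 8)` for every `2`-adic unit). [cite: Iwasawa1972PadicL, §4.4] -/
theorem two_le_valuation_padicLog {W : WeierstrassCurve ℚ} [W.IsElliptic] (Dq : TateParameterData W 2)
    (hlog : padicLog 2 Dq.q ≠ 0) :
    (2 : ℤ) ≤ (padicLog 2 Dq.q).valuation := by
  obtain ⟨k', u, hqu⟩ := exists_eq_two_pow_mul_units Dq.q_ne_zero Dq.norm_q_lt_one
  have hu0 : ((u : ℤ_[2]) : ℚ_[2]) ≠ 0 := fun h ↦ u.ne_zero (PadicInt.coe_eq_zero.mp h)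
  have hlogq : padicLog 2 Dq.q = padicLog 2 ((u : ℤ_[2]) : ℚ_[2]) := by rw [hqu, padicLog_two_pow_mul k' hu0]
  have hn := norm_padicLog_units_eq u
  rw [← hlogq, Padic.norm_eq_zpow_neg_valuation hlog] at hn
  have h8 := norm_units_sq_sub_one_le u
  have hle : ((2 : ℕ) : ℝ) ^ (-(padicLog 2 Dq.q).valuation) ≤ (2 : ℝ) ^ (-(2 : ℤ)) := by
    rw [show -(2 : ℤ) = 1 + (-(3 : ℤ)) by norm_num, zpow_add₀ (by norm_num : (2 : ℝ) ≠ 0), zpow_one]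
    push_cast at hn ⊢
    rw [hn]
    linarith [h8]
  push_cast at hle
  have h2 : (1 : ℝ) < 2 := by norm_num
  have := (zpow_le_zpow_iff_right₀ h2).mp hle
  omega

/-- **`#𝒦_{v,n}[2^∞] = 2^w` EXACTLY at a split multiplicative `2` with `ord₂(log₂ q_E) = w + 2`, every layer** — Greenberg's
`|ker(r_{v_n})| ∼ log₂(N q_E)/4[…] = log₂(q_E)/4` over `ℚ` at `p = 2` (LNM 1716 p. 93), KERNEL: the upper bound is seat
bsd-2adic-mult GEN 13's `MultTowerSplitOrder.finite_and_natCard_localTowerKerPrimary_le_pow_splitTwo`, the lower bound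
`pow_le_natCard_localTowerKerPrimary_splitTwo`. [cite: GreenbergLNM1716, §3, between Prop. 3.6 and Prop. 3.7 (PDF pp. 92–93)]
[cite: SilvermanATAEC1994, Thm. V.3.1, V.5.3] [cite: NeukirchANT1999, Ch. IV (3.5) and Ch. V §1 Thm. (1.1)] -/
theorem finite_and_natCard_localTowerKerPrimary_eq_pow_splitTwo (W : WeierstrassCurve ℚ) [W.IsElliptic]
    (Dq : TateParameterData W 2) (hlog : padicLog 2 Dq.q ≠ 0) {w : ℕ}
    (hw : (padicLog 2 Dq.q).valuation = (w : ℤ) + 2) (κ : ZpExtension ℚ 2) (hκ : κ.IsCyclotomic)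
    (v : HeightOneSpectrum (𝓞 ℚ)) (hv : ((2 : ℕ) : 𝓞 ℚ) ∈ v.asIdeal) (n : ℕ) :
    Finite (W.localTowerKerPrimary κ (v.adicCompletion ℚ) n) ∧
      Nat.card (W.localTowerKerPrimary κ (v.adicCompletion ℚ) n) = 2 ^ w := by
  obtain ⟨hfin, hle⟩ := finite_and_natCard_localTowerKerPrimary_le_pow_splitTwo W Dq hlog (k := w) hw.le κ hκ v hv n
  exact ⟨hfin, le_antisymm hle (pow_le_natCard_localTowerKerPrimary_splitTwo W Dq hlog hw κ hκ v hv n)⟩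

/-- **The `p = 2` clause of the named fact `Greenberg1999.sec3_natCard_localTowerKerPrimary_splitMultiplicative_rat`, body
verbatim** (Greenberg, LNM 1716 §3 pp. 92–93 read over the tower of `ℚ`, flag `Gre99-p93-split-Qtower`): for `W/ℚ` globally
minimal with a Tate parameter datum `Dq` at `2` and `log₂ q_E ≠ 0`, the cyclotomic `κ` and `v ∋ 2`, there is `e` with
`e + ord₂(2·2) = ord₂(log₂ q_E)` such that at EVERY layer `𝒦_{v,n}[2^∞]` is finite of order `2^e`. The `∀ p` named fact is NOT
discharged by this (the odd-`p` clause is open in the tree). [cite: GreenbergLNM1716, §3, between Prop. 3.6 and Prop. 3.7 (PDF pp. 90–93)]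
[cite: Washington1997, §13.1] -/
theorem sec3_natCard_localTowerKerPrimary_splitMultiplicative_two (W : WeierstrassCurve ℚ) [W.IsElliptic]
    [W.IsGloballyMinimal] (Dq : TateParameterData W 2) (hlog : padicLog 2 Dq.q ≠ 0)
    (κ : ZpExtension ℚ 2) (hκ : κ.IsCyclotomic) (v : HeightOneSpectrum (𝓞 ℚ)) (hv : ((2 : ℕ) : 𝓞 ℚ) ∈ v.asIdeal) :
    ∃ e : ℕ, (e : ℤ) + (padicValNat 2 (2 * 2) : ℤ) = (padicLog 2 Dq.q).valuation ∧
      ∀ n : ℕ, Finite (W.localTowerKerPrimary κ (v.adicCompletion ℚ) n) ∧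
        Nat.card (W.localTowerKerPrimary κ (v.adicCompletion ℚ) n) = 2 ^ e := by
  have h4 : padicValNat 2 (2 * 2) = 2 := by
    have : (2 * 2 : ℕ) = 2 ^ 2 := by norm_num
    rw [this, padicValNat.prime_pow]
  have h2 := two_le_valuation_padicLog Dq hlog
  obtain ⟨w, hw⟩ : ∃ w : ℕ, (padicLog 2 Dq.q).valuation = (w : ℤ) + 2 :=
    ⟨((padicLog 2 Dq.q).valuation - 2).toNat, by rw [Int.toNat_of_nonneg (by omega)]; ring⟩
  refine ⟨w, by rw [h4, hw]; push_cast; ring, fun n ↦ ?_⟩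
  exact finite_and_natCard_localTowerKerPrimary_eq_pow_splitTwo W Dq hlog hw κ hκ v hv n

end Summit.BirchSwinnertonDyer.BirchSwinnertonDyer.Theorems.MultTowerSplitExact

end
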